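import Literature.AlgebraicGeometry.Resolution.ApproximationDegreeCompose
import Literature.AlgebraicGeometry.Resolution.Kuhlmann2019Lemma41
import Literature.AlgebraicGeometry.Resolution.Kuhlmann2019Lemma42NormalForm
import HarnessLib

/-!
# Mutual henselization generators have relative approximation degree one (Kuhlmann–Vlahu 2014, Cor. 10.8)

Topic: `Literature/AlgebraicGeometry/Resolution` (valued function fields). Continuation of
`ApproximationDegree.lean` / `ApproximationDegreeCompose.lean`: F.-V. Kuhlmann, I. Vlahu,
*The relative approximation degree in valued function fields*, Math. Z. 276 (2014) =
arXiv:1304.0200: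

> **Corollary 10.8.** Assume that (10.1) holds. Then `K(x)^h = K(y)^h ⟺ 𝐡_K(x:y) = 1`.
> *Proof.* If `K(x)^h = K(y)^h`, then `x ∈ K(y)^h` and `y ∈ K(x)^h`, and by Lemma 10.6 we have
> that `𝐡_K(x:y) · 𝐡_K(y:x) = 𝐡_K(x:x) = 1`, which yields `𝐡_K(x:y) = 1`.

This file PROVES the direction "⇒" in relative approximation degree `1`, in the form consumed by
§12–14 (Lemma 14.4: "it follows that every `ρᵢ(x)` is transcendental … In view of the previous
lemma and Corollary 10.8 we have that `𝐡_K(x:ρᵢ(x)) = 1`"): a polynomial `f` over `K` with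
`f(x)` a good approximant of `y` and DOMINANT LINEAR Taylor term at `x`. The definition of
`𝐡_K(x:y)` through such an `f` (§10, after Lemma 10.2) is thereby bypassed: the conclusion is
stated for the concrete `f` (and transfers to every good approximant by Lemma 7.2,
`approximationDegree_congr`).

## Content (everything PROVED; no definitions, no named facts)

* `valuation_eval_sub_eval_lt_of_taylor` — continuity of polynomials (Taylor bound).
* `exists_good_approximant_of_degree_one` — **Cor. 10.8 (⇒) with `𝐡 = 1`**
  [cite: KuhlmannVlahu2014, Cor. 10.8].

## Sources

* F.-V. Kuhlmann, I. Vlahu, Math. Z. 276 (2014) = arXiv:1304.0200: Lemma 10.1 (density; tree: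
  `Kuhlmann2019Lemma41.lean`), Lemma 10.2, Lemma 10.6, Cor. 10.8 (pp. 20–21); Lemma 14.4.
  [KuhlmannVlahu2014]

## Rendering notes

As in `ApproximationDegree.lean`. "(10.1)": rank one (`IsRankOneValued` of `K(x)`, `K(y)`),
immediate (`IsImmediateOver`), transcendental approximation type (`h3`), and "`x ∉ K^c`" as a
witness `e_x ∈ K^×` with `|e_x| ≤ |x − b|` for all `b ∈ K` (likewise for `y`).
-/

noncomputable section

open Polynomial Finset

namespace Literature.AlgebraicGeometry.Resolution

universe u

variable {Ω : Type u} [Field Ω] [IsAlgClosed Ω] (V : ValuationSubring Ω) (K : Subfield Ω)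

omit [IsAlgClosed Ω] in
/-- Continuity of a polynomial at `y` along its Taylor expansion: if `|y' − y| < |π|` with
`|π| ≤ 1` and `|gᵢ(y)| · |π| < ε` for all `1 ≤ i ≤ deg g`, then `|g(y') − g(y)| < ε`.
[folklore] -/
theorem valuation_eval_sub_eval_lt_of_taylor {g : Polynomial Ω} {y y' π : Ω} {ε : V.ValueGroup}
    (hε : ε ≠ 0) (hπ1 : V.valuation π ≤ 1) (hclose : V.valuation (y' - y) < V.valuation π)
    (hsmall : ∀ i, 1 ≤ i → i ≤ g.natDegree →
      V.valuation ((hasseDeriv i g).eval y) * V.valuation π < ε) :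
    V.valuation (g.eval y' - g.eval y) < ε := by
  classical
  set n := g.natDegree with hn
  have htaylor : g.eval y' - g.eval y =
      ∑ i ∈ Finset.Icc 1 n, (hasseDeriv i g).eval y * (y' - y) ^ i := by
    have h1 : g.eval y' = (taylor y g).eval (y' - y) := by rw [taylor_eval, sub_add_cancel]
    have hdegT : (taylor y g).natDegree < n + 1 := by
      rw [natDegree_taylor]; exact Nat.lt_succ_self _
    rw [h1, eval_eq_sum_range' hdegT, Finset.range_eq_Ico,
      Finset.sum_eq_sum_Ico_succ_bot (Nat.succ_pos n)]
    simp only [taylor_coeff, hasseDeriv_zero, LinearMap.id_apply, pow_zero, mul_one]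
    have hIco : Finset.Ico 1 (n + 1) = Finset.Icc 1 n := by ext i; simp
    rw [hIco]; ring
  rw [htaylor]
  refine Valuation.map_sum_lt _ hε fun i hi => ?_
  obtain ⟨hi1, hin⟩ := Finset.mem_Icc.mp hi
  rw [map_mul, map_pow]
  have hyy : V.valuation (y' - y) ≤ 1 := hclose.le.trans hπ1
  calc V.valuation ((hasseDeriv i g).eval y) * V.valuation (y' - y) ^ i
      ≤ V.valuation ((hasseDeriv i g).eval y) * V.valuation (y' - y) := by
        refine mul_le_mul' le_rfl ?_
        calc V.valuation (y' - y) ^ i = V.valuation (y' - y) ^ (i - 1) * V.valuation (y' - y) := by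
              rw [← pow_succ, Nat.sub_add_cancel hi1]
          _ ≤ 1 * V.valuation (y' - y) := mul_le_mul' (pow_le_one' hyy _) le_rfl
          _ = V.valuation (y' - y) := one_mul _
    _ ≤ V.valuation ((hasseDeriv i g).eval y) * V.valuation π := mul_le_mul' le_rfl hclose.le
    _ < ε := hsmall i hi1 hin

/-- **Kuhlmann–Vlahu 2014, Cor. 10.8 (⇒), in relative approximation degree one.** Let `K ≤ Ω`,
and `x, y ∈ Ω` transcendental over `K` with `(K(x)|K)`, `(K(y)|K)` immediate, of rank one and of
transcendental approximation type, neither `x` nor `y` a limit of elements of `K`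
(`|e_x| ≤ |x − b|`, `|e_y| ≤ |y − b|` for all `b ∈ K`, some `e_x, e_y ∈ K^×`), and assume that `x`
and `y` generate THE SAME henselization: `x ∈ K(y)^h` and `y ∈ K(x)^h`. Then
`𝐡_K(x : y) = 1`: there is a polynomial `f` over `K` such that `f(x)` approximates `y` at least as
well as every element of `K` ("`v(y − f(x)) ≥ dist(y,K)`"), and `f` has relative approximation
degree `1` at `x` — `|f(x) − f(c)| = β |x − c|`, `|f₁(c)| = β` and the linear Taylor term strictly
dominates, for `c ∈ K` close to `x`. Printed proof: "`𝐡_K(x:y) · 𝐡_K(y:x) = 𝐡_K(x:x) = 1`"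
(Lemma 10.6); here: choose `g` with `x ≈ g(y)` (density of `K[y]` in `K(y)^h`, Lemma 10.1), then
`f` with `f(x)` so close to `y` that `g(f(x)) ≈ x` within `dist(x,K)`; by Lemma 7.2
`𝐡(x : g∘f) = 𝐡(x : X) = 1`, and by Lemma 10.6 `𝐡(x : g∘f) = 𝐡(x:f) · 𝐡(f(x):g)`.
[cite: KuhlmannVlahu2014, Cor. 10.8] -/
theorem exists_good_approximant_of_degree_one {x y : Ω}
    (htransx : ∀ P : Polynomial Ω, (∀ k, P.coeff k ∈ K) → P.eval x = 0 → P = 0)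
    (himmx : IsImmediateOver V K (Subfield.closure ((K : Set Ω) ∪ {x})))
    (h3x : ∀ g : Polynomial Ω, (∀ k, g.coeff k ∈ K) → ∃ a₀ ∈ K, ∃ α : V.ValueGroup,
      ∀ a ∈ K, V.valuation (x - a) ≤ V.valuation (x - a₀) → V.valuation (g.eval a) = α)
    (hr1x : IsRankOneValued V (Subfield.closure ((K : Set Ω) ∪ {x})))
    (htransy : ∀ P : Polynomial Ω, (∀ k, P.coeff k ∈ K) → P.eval y = 0 → P = 0)
    (himmy : IsImmediateOver V K (Subfield.closure ((K : Set Ω) ∪ {y})))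
    (h3y : ∀ g : Polynomial Ω, (∀ k, g.coeff k ∈ K) → ∃ a₀ ∈ K, ∃ α : V.ValueGroup,
      ∀ a ∈ K, V.valuation (y - a) ≤ V.valuation (y - a₀) → V.valuation (g.eval a) = α)
    (hr1y : IsRankOneValued V (Subfield.closure ((K : Set Ω) ∪ {y})))
    {ex : Ω} (hexK : ex ∈ K) (hex0 : ex ≠ 0) (hex : ∀ b ∈ K, V.valuation ex ≤ V.valuation (x - b))
    {ey : Ω} (heyK : ey ∈ K) (hey0 : ey ≠ 0) (hey : ∀ b ∈ K, V.valuation ey ≤ V.valuation (y - b))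
    (hxy : x ∈ henselization V (Subfield.closure ((K : Set Ω) ∪ {y})))
    (hyx : y ∈ henselization V (Subfield.closure ((K : Set Ω) ∪ {x}))) :
    ∃ f : Polynomial Ω, (∀ k, f.coeff k ∈ K) ∧ 0 < f.natDegree ∧
      (∀ b ∈ K, V.valuation (y - f.eval x) < V.valuation (y - b)) ∧
      ∃ β : V.ValueGroup, β ≠ 0 ∧ ∃ a₀ ∈ K,
        ∀ c ∈ K, V.valuation (x - c) ≤ V.valuation (x - a₀) →
          V.valuation ((hasseDeriv 1 f).eval c) = β ∧
          (∀ i, 1 ≤ i → i ≠ 1 →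
            V.valuation ((hasseDeriv i f).eval c * (x - c) ^ i) < β * V.valuation (x - c) ^ 1) ∧
          V.valuation (f.eval x - f.eval c) = β * V.valuation (x - c) ^ 1 := by
  classical
  set Kx : Subfield Ω := Subfield.closure ((K : Set Ω) ∪ {x}) with hKx
  set Ky : Subfield Ω := Subfield.closure ((K : Set Ω) ∪ {y}) with hKy
  have hKKx : K ≤ Kx := fun c hc => Subfield.subset_closure (Or.inl hc)
  have hKKy : K ≤ Ky := fun c hc => Subfield.subset_closure (Or.inl hc)
  have hxK : x ∉ K := not_mem_of_forall_eval_eq_zero K htransx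
  have hyK : y ∉ K := not_mem_of_forall_eval_eq_zero K htransy
  -- immediateness data
  have hvalx : ∀ w ∈ Kx, w ≠ 0 → ∃ b ∈ K, V.valuation w = V.valuation b := himmx.1
  have hvaly : ∀ w ∈ Ky, w ≠ 0 → ∃ b ∈ K, V.valuation w = V.valuation b := himmy.1
  have hresx : ∀ w ∈ Kx, w ∈ V → ∃ c ∈ K, V.valuation (w - c) < 1 := by
    intro w hw hwV
    have hrw : IsLocalRing.residue V ⟨w, hwV⟩ ∈ resField V K :=
      himmx.2 (residue_mem_resField V ⟨w, hwV⟩ hw)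
    obtain ⟨c, hcK, hcw⟩ := (mem_resField_iff V K _).mp hrw
    refine ⟨c, hcK, ?_⟩
    have h0 : IsLocalRing.residue V (⟨w, hwV⟩ - c) = 0 := by rw [map_sub, hcw, sub_self]
    exact (ValuationSubring.valuation_lt_one_iff V (⟨w, hwV⟩ - c)).mp
      ((IsLocalRing.residue_eq_zero_iff _).mp h0)
  have hresy : ∀ w ∈ Ky, w ∈ V → ∃ c ∈ K, V.valuation (w - c) < 1 := by
    intro w hw hwV
    have hrw : IsLocalRing.residue V ⟨w, hwV⟩ ∈ resField V K :=
      himmy.2 (residue_mem_resField V ⟨w, hwV⟩ hw)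
    obtain ⟨c, hcK, hcw⟩ := (mem_resField_iff V K _).mp hrw
    refine ⟨c, hcK, ?_⟩
    have h0 : IsLocalRing.residue V (⟨w, hwV⟩ - c) = 0 := by rw [map_sub, hcw, sub_self]
    exact (ValuationSubring.valuation_lt_one_iff V (⟨w, hwV⟩ - c)).mp
      ((IsLocalRing.residue_eq_zero_iff _).mp h0)
  have hvex0 : V.valuation ex ≠ 0 := (_root_.map_ne_zero _).mpr hex0
  have hvey0 : V.valuation ey ≠ 0 := (_root_.map_ne_zero _).mpr hey0
  ---------------------------------------------------------------- Step 1: `g` with `x ≈ g(y)`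
  obtain ⟨g, hg, hgx⟩ := exists_polynomial_valuation_sub_lt_of_mem_henselization V K hyK hvaly
    hresy h3y hr1y hxy (hKKy hexK) hex0
  -- `g` is good for `x`, strictly
  have hggood : ∀ b ∈ K, V.valuation (x - g.eval y) < V.valuation (x - b) :=
    fun b hb => lt_of_lt_of_le hgx (hex b hb)
  ---------------------------------------------------------------- Step 2: the threshold for `f`
  obtain ⟨π, hπK, hπ0, hπ1⟩ := exists_valuation_lt_one_of_immediate V hyK hvaly hresy
  have hvπ0 : V.valuation π ≠ 0 := (_root_.map_ne_zero _).mpr hπ0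
  -- `n` large: `|π|^n < |e_y|` and `|gᵢ(y)| |π|^n < |e_x|` for `1 ≤ i ≤ deg g`
  have hyKy : y ∈ Ky := Subfield.subset_closure (Or.inr rfl)
  have hgiy : ∀ i, (hasseDeriv i g).eval y ∈ Ky := fun i =>
    eval_mem_subfield_of_coeff_mem (fun k => hKKy (coeff_hasseDeriv_mem K hg i k)) hyKy
  obtain ⟨n₀, hn₀⟩ := IsRankOneValued.exists_forall_mul_pow_lt hr1y (hKKy hπK) hπ1
    (Ky.one_mem) (hKKy heyK) hey0
  have hn : ∀ i ∈ Finset.Icc 1 g.natDegree, ∃ nᵢ : ℕ, ∀ m, nᵢ ≤ m →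
      V.valuation ((hasseDeriv i g).eval y) * V.valuation π ^ m < V.valuation ex := fun i _ =>
    IsRankOneValued.exists_forall_mul_pow_lt hr1y (hKKy hπK) hπ1 (hgiy i) (hKKy hexK) hex0
  choose! nn hnn using hn
  set N : ℕ := max n₀ ((Finset.Icc 1 g.natDegree).sup nn) + 1 with hN
  have hNn₀ : n₀ ≤ N := by omega
  have hNi : ∀ i ∈ Finset.Icc 1 g.natDegree, nn i ≤ N := fun i hi => by
    have := Finset.le_sup (f := nn) hi
    omega
  set cc : Ω := π ^ N with hcc
  have hccK : cc ∈ K := K.pow_mem hπK N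
  have hcc0 : cc ≠ 0 := pow_ne_zero _ hπ0
  have hvcc : V.valuation cc = V.valuation π ^ N := by rw [hcc, map_pow]
  have hcc1 : V.valuation cc ≤ 1 := by rw [hvcc]; exact pow_le_one' hπ1.le _
  have hccey : V.valuation cc < V.valuation ey := by
    have := hn₀ N hNn₀
    rwa [map_one, one_mul, ← hvcc] at this
  have hccg : ∀ i, 1 ≤ i → i ≤ g.natDegree →
      V.valuation ((hasseDeriv i g).eval y) * V.valuation cc < V.valuation ex := by
    intro i hi1 hin
    have hi : i ∈ Finset.Icc 1 g.natDegree := Finset.mem_Icc.mpr ⟨hi1, hin⟩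
    rw [hvcc]
    exact hnn i hi N (hNi i hi)
  ---------------------------------------------------------------- Step 3: `f` with `y ≈ f(x)`
  obtain ⟨f, hf, hfy⟩ := exists_polynomial_valuation_sub_lt_of_mem_henselization V K hxK hvalx
    hresx h3x hr1x hyx (hKKx hccK) hcc0
  -- `f` is good for `y`, strictly
  have hfgood : ∀ b ∈ K, V.valuation (y - f.eval x) < V.valuation (y - b) :=
    fun b hb => lt_of_lt_of_le (hfy.trans hccey) (hey b hb)
  -- `f` is non-constant
  have hdegf : 0 < f.natDegree := by
    by_contra h0
    obtain ⟨f₀, hf₀⟩ := natDegree_eq_zero.mp (Nat.eq_zero_of_not_pos h0)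
    have hf₀K : f₀ ∈ K := by have := hf 0; rwa [← hf₀, coeff_C_zero] at this
    have h := hfgood f₀ hf₀K
    rw [← hf₀, eval_C] at h
    exact lt_irrefl _ h
  ---------------------------------------------------------------- Step 4: `x ≈ g(f(x))` within `dist(x,K)`
  have hgfx : V.valuation (g.eval (f.eval x) - g.eval y) < V.valuation ex := by
    refine valuation_eval_sub_eval_lt_of_taylor V hvex0 hcc1 ?_ hccg
    rw [Valuation.map_sub_swap]; exact hfy
  have hgood_gf : ∀ b ∈ K, V.valuation (x - (g.comp f).eval x) < V.valuation (x - b) := by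
    intro b hb
    rw [eval_comp]
    have hid : x - g.eval (f.eval x) = (x - g.eval y) + -(g.eval (f.eval x) - g.eval y) := by ring
    rw [hid]
    refine lt_of_le_of_lt (Valuation.map_add _ _ _) (max_lt (hggood b hb) ?_)
    rw [Valuation.map_neg]
    exact lt_of_lt_of_le hgfx (hex b hb)
  ---------------------------------------------------------------- Step 5: the degrees
  -- `f` at `x`
  obtain ⟨kf, hkf1, -, βf, hβf, a₀, ha₀K, hfdat⟩ :=
    exists_approximationDegree V K hxK hvalx hresx h3x hf hdegf
  -- `g` is non-constant
  have hdegg : 0 < g.natDegree := by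
    by_contra h0
    obtain ⟨g₀, hg₀⟩ := natDegree_eq_zero.mp (Nat.eq_zero_of_not_pos h0)
    have hg₀K : g₀ ∈ K := by have := hg 0; rwa [← hg₀, coeff_C_zero] at this
    have h := hggood g₀ hg₀K
    rw [← hg₀, eval_C] at h
    exact lt_irrefl _ h
  -- `g` at `y`
  obtain ⟨kg, hkg1, -, βg, hβg, b₀, hb₀K, hgdat⟩ :=
    exists_approximationDegree V K hyK hvaly hresy h3y hg hdegg
  -- transfer of `g`'s data from `y` to `f(x)`: the balls agree, and `|g(f x) - g(a)| = |g(y) - g(a)|`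
  have hgk : ∀ a ∈ K, V.valuation (f.eval x - a) ≤ V.valuation (f.eval x - b₀) →
      V.valuation (g.eval (f.eval x) - g.eval a) = βg * V.valuation (f.eval x - a) ^ kg := by
    intro a ha hle
    -- `|f(x) - a'| = |y - a'|` for all `a' ∈ K`
    have hdist : ∀ a' ∈ K, V.valuation (f.eval x - a') = V.valuation (y - a') := by
      intro a' ha'
      have hid : f.eval x - a' = (y - a') - (y - f.eval x) := by ring
      rw [hid, Valuation.map_sub_eq_of_lt_left _ (hfgood a' ha')]
    rw [hdist a ha] at hle ⊢
    rw [hdist b₀ hb₀K] at hle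
    have hga : V.valuation (g.eval y - g.eval a) = βg * V.valuation (y - a) ^ kg :=
      (hgdat a ha hle).2.2
    -- `|g(y) - g(a)| = |x - g(a)| ≥ |e_x| > |g(f x) - g(y)|`
    have hgaK : g.eval a ∈ K := eval_mem_subfield_of_coeff_mem hg ha
    have hbig : V.valuation ex ≤ V.valuation (g.eval y - g.eval a) := by
      have hid : g.eval y - g.eval a = (x - g.eval a) - (x - g.eval y) := by ring
      rw [hid, Valuation.map_sub_eq_of_lt_left _ (hggood _ hgaK)]
      exact hex _ hgaK
    have hid : g.eval (f.eval x) - g.eval a = (g.eval y - g.eval a) + (g.eval (f.eval x) - g.eval y) := by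
      ring
    rw [hid, Valuation.map_add_eq_of_lt_left _ (lt_of_lt_of_le hgfx (by exact hbig)), hga]
  -- Lemma 10.6: `|(g∘f)(x) - (g∘f)(c)| = βg βf^kg t^(kf kg)` near `x`
  have hfk : ∀ c ∈ K, V.valuation (x - c) ≤ V.valuation (x - a₀) →
      V.valuation (f.eval x - f.eval c) = βf * V.valuation (x - c) ^ kf :=
    fun c hc hle => (hfdat c hc hle).2.2
  obtain ⟨a₁, ha₁K, hcomp⟩ := approximationDegree_comp V K htransx hvalx hresx h3x hf hdegf ha₀K
    hfk hb₀K hgk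
  -- Lemma 7.2 with `X`: `|(g∘f)(x) - (g∘f)(c)| = 1 · t^1` near `x`
  have hXK : ∀ k, (X : Polynomial Ω).coeff k ∈ K := fun k => by
    rw [coeff_X]; split_ifs
    · exact K.one_mem
    · exact K.zero_mem
  have hgfK : ∀ k, (g.comp f).coeff k ∈ K := by
    obtain ⟨g', hg'⟩ : ∃ g' : Polynomial K, g'.map (algebraMap K Ω) = g :=
      (Polynomial.mem_lifts g).mp
        ((Polynomial.lifts_iff_coeff_lifts g).mpr fun k => ⟨⟨g.coeff k, hg k⟩, rfl⟩)
    obtain ⟨f', hf'⟩ : ∃ f' : Polynomial K, f'.map (algebraMap K Ω) = f :=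
      (Polynomial.mem_lifts f).mp
        ((Polynomial.lifts_iff_coeff_lifts f).mpr fun k => ⟨⟨f.coeff k, hf k⟩, rfl⟩)
    intro k
    rw [← hg', ← hf', ← Polynomial.map_comp, coeff_map]
    exact SetLike.coe_mem _
  have hXdat : ∀ c ∈ K, V.valuation (x - c) ≤ V.valuation (x - a₀) →
      V.valuation ((X : Polynomial Ω).eval x - (X : Polynomial Ω).eval c) =
        1 * V.valuation (x - c) ^ 1 := by
    intro c _ _
    rw [eval_X, eval_X, one_mul, pow_one]
  obtain ⟨a₂, ha₂K, h72⟩ := approximationDegree_congr V K hxK hvalx hresx h3x hXK hgfK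
    (fun b hb => by rw [eval_X]; exact (hgood_gf b hb).le) one_ne_zero one_ne_zero ha₀K hXdat
  -- uniqueness on a common ball: `kf * kg = 1`
  obtain ⟨a₃, ha₃K, ha₃⟩ : ∃ a₃ ∈ K, V.valuation (x - a₃) ≤ V.valuation (x - a₁) ∧
      V.valuation (x - a₃) ≤ V.valuation (x - a₂) := by
    rcases le_total (V.valuation (x - a₁)) (V.valuation (x - a₂)) with h | h
    · exact ⟨a₁, ha₁K, le_rfl, h⟩
    · exact ⟨a₂, ha₂K, h, le_rfl⟩
  have huniq := approximationDegree_unique V K hxK hvalx hresx ha₃K (β := 1)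
    (β' := βg * βf ^ kg) one_ne_zero (mul_ne_zero hβg (pow_ne_zero _ hβf)) (k := 1)
    (k' := kf * kg) (fun c hc hle => by
      rw [← h72 c hc (hle.trans ha₃.2), hcomp c hc (hle.trans ha₃.1)])
  have hkf : kf = 1 := Nat.eq_one_of_mul_eq_one_right huniq.1.symm
  refine ⟨f, hf, hdegf, hfgood, βf, hβf, a₀, ha₀K, fun c hc hle => ?_⟩
  have h := hfdat c hc hle
  rw [hkf] at h
  exact h

end Literature.AlgebraicGeometry.Resolution
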